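import Literature.NumberTheory.LFunctions.KMVDiagonalSlack

/-!
LANDING NOTE (typer ls-idea-typ-1 gen 1, cell ls-idea): authored by seat ls-idea-lens-6 gen 3 (sketch #6
`Sketch_OrderLedgerPolar.lean` sha16 cc273b7fd2bf14c0, `lean check` rc 0; card K6-10 «THE ORDER LEDGER»
§v6f worked instance; critics A PASS as STRUCTURE/LEDGER + INSTRUMENT and PASS worked instance (algebra
re-derived) · B PASS (batch 22/22b, algebra re-derived; BN-15 «W-OPT» adopted) · C (gen 3) pending).
Landed in the `KMV2000` namespace next to `secondMomentForm` (the sketch's duplicate of the tree's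
`secondMomentForm_X_sq_one` dropped; cite tags added). PROVED main-term algebra only — nothing about
L-functions, no error terms. «The programme SEARCHES and TYPES; no claim about Landau–Siegel zeros,
Theorems 1–2 of arXiv:2211.02515 or a repaired Margin232 until a kernel theorem says so.»

## References
* [KowalskiMichelVanderKam2000] J. reine angew. Math. 526 (2000), Thm. 6.1 (32), §6 p. 19 (the quadratic
  main-term forms; tree `KMV2000.linForm/offDiagForm/secondMomentForm`). [held: paper:doi-10-1515-crll-2000-074]
* [CechMatomaki2024] M. Čech, K. Matomäki, Math. Ann. 389 (2024) = arXiv:2303.05277, Remark 2.9 (the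
  non-improvement / equality case; p. 4 L8–9 byte-checked by referee B). [held: paper:arxiv-2303.05277]

# The POLAR main-term form of two one-piece mollifiers and the Čech–Matomäki defect on KMV's forms
# (card K6-10 «ORDER LEDGER», §v6f worked instance; seat ls-idea-lens-6)

For the central value (`Q = 1`) the mixed main terms of two one-piece mollifiers with profiles `P`, `N`
at the same logarithmic length `Δ` polarise to `B_Δ(P,N) = P′(1)N′(1) + Δ⁻¹ ∫₀¹ P″N″`, and the
(normalised) Čech–Matomäki non-improvement criterion reads
`𝔇_Δ(P;N) := B_Δ(P,N)·P′(1) − secondMomentForm(P)·N′(1) = 0`. PROVED here: `B_Δ(P,P) = secondMomentForm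
Δ P 1` (polarisation is consistent); at the optimal profile `P = X²`: `𝔇_Δ(X²;N) = −(4/Δ)·N′(0)` for
EVERY polynomial `N`, hence `= 0` on the admissible class (`N(0) = N′(0) = 0`) — ČM's criterion within a
linear class IS KMV stationarity; control `𝔇_Δ(X³;X²) = −6/Δ` (detector not vacuous). Toy, kernel-checked
MAIN-TERM ALGEBRA only.
-/

noncomputable section

open Polynomial intervalIntegral MeasureTheory Set

namespace Literature.NumberTheory.LFunctions.KMV2000

/-- Polynomial functions are interval-integrable (re-proved; the library's copies are private). [folklore] -/
private theorem ii (R : ℝ[X]) (a b : ℝ) :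
    IntervalIntegrable (fun y : ℝ => R.eval y) volume a b :=
  (Polynomial.continuous R).intervalIntegrable a b

/-- `∫₀¹ S′ = S(1) − S(0)` (re-proved; the library's copy is private). [folklore] -/
private theorem unitIntegral_derivative' (S : ℝ[X]) :
    unitIntegral (derivative S) = S.eval 1 - S.eval 0 := by
  unfold unitIntegral
  exact integral_eq_sub_of_hasDerivAt (fun x _ => Polynomial.hasDerivAt S x) (ii _ 0 1)

/-- `∫₀¹ c·R = c·∫₀¹ R` (re-proved; the library's copy is private). [folklore] -/
private theorem unitIntegral_C_mul' (c : ℝ) (R : ℝ[X]) :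
    unitIntegral (C c * R) = c * unitIntegral R := by
  unfold unitIntegral
  simp only [eval_mul, eval_C]
  exact intervalIntegral.integral_const_mul c _

/-- The POLAR (bilinear) main-term form at `Q = 1`: `B_Δ(P,N) = P′(1)N′(1) + Δ⁻¹∫₀¹ P″N″` — the
polarisation of KMV's quadratic second-moment form `secondMomentForm Δ P 1` (mixed main term of two
one-piece mollifiers with profiles `P`, `N` at the same logarithmic length `Δ`). A DEFINITION (card K6-10
§v6f instrument). [cite: KowalskiMichelVanderKam2000, Thm. 6.1 (32) and §6 p. 19] -/
def polarB (Δ : ℝ) (P N : ℝ[X]) : ℝ :=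
  (derivative P).eval 1 * (derivative N).eval 1
    + Δ⁻¹ * unitIntegral (derivative (derivative P) * derivative (derivative N))

/-- The Čech–Matomäki defect `𝔇_Δ(P;N) = B_Δ(P,N)·P′(1) − secondMomentForm(P)·N′(1)` (normalised
non-improvement criterion of a one-piece test profile `N` against `P`: `= 0` iff `N` cannot improve `P` to
first order; card K6-10 (iv) reads ČM's Remark 2.9 equality case on KMV's forms). A DEFINITION. [cite: CechMatomaki2024, Remark 2.9] [cite: KowalskiMichelVanderKam2000, Thm. 6.1 (32) and §6 p. 19] -/
def cmDefect (Δ : ℝ) (P N : ℝ[X]) : ℝ :=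
  polarB Δ P N * (derivative P).eval 1 - secondMomentForm Δ P 1 * (derivative N).eval 1

/-- Polarisation is consistent with the tree's quadratic form: `B_Δ(P,P) = secondMomentForm Δ P 1`
(proved). [cite: KowalskiMichelVanderKam2000, Thm. 6.1 (32) and §6 p. 19] -/
theorem polarB_self (Δ : ℝ) (P : ℝ[X]) : polarB Δ P P = secondMomentForm Δ P 1 := by
  unfold polarB secondMomentForm
  rw [linForm_one, offDiagForm_one, ← pow_two, ← pow_two]

/-- `B_Δ(X², N) = 2N′(1) + Δ⁻¹·2·(N′(1) − N′(0))` for every polynomial `N` (integration by parts is just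
`∫₀¹ 2·N″ = 2(N′(1) − N′(0))`; proved). [cite: KowalskiMichelVanderKam2000, Thm. 6.1 (32) and §6 p. 19] -/
theorem polarB_X_sq (Δ : ℝ) (N : ℝ[X]) :
    polarB Δ (X ^ 2) N
      = 2 * (derivative N).eval 1 + Δ⁻¹ * (2 * ((derivative N).eval 1 - (derivative N).eval 0)) := by
  unfold polarB
  have hdd : derivative (derivative (X ^ 2 : ℝ[X])) = C 2 := by
    rw [derivative_X_sq, derivative_C_mul, derivative_X, mul_one]
  rw [hdd, unitIntegral_C_mul', unitIntegral_derivative', derivative_X_sq]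
  simp only [eval_mul, eval_C, eval_X, mul_one]

/-- **The worked instance (card K6-10 §v6f; critics A/B re-derived the algebra).** At the optimal profile
`P = X²` the Čech–Matomäki defect is `−(4/Δ)·N′(0)` for EVERY polynomial test profile `N` (all `Δ ≠ 0`;
at `Δ = 0` both sides are `0` by the junk value `0⁻¹ = 0`). Proved. [cite: CechMatomaki2024, Remark 2.9] [cite: KowalskiMichelVanderKam2000, Thm. 6.1 (32) and §6 p. 19] -/
theorem cmDefect_X_sq (Δ : ℝ) (N : ℝ[X]) :
    cmDefect Δ (X ^ 2) N = -(4 * Δ⁻¹) * (derivative N).eval 0 := by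
  unfold cmDefect
  rw [polarB_X_sq, secondMomentForm_X_sq_one, derivative_X_sq]
  simp only [eval_mul, eval_C, eval_X, mul_one]
  field_simp
  ring

/-- Hence the criterion holds identically on KMV's admissible class: no admissible one-piece test profile
improves `X²` (ČM-criterion-within-the-linear-class = KMV stationarity = Euler–Lagrange of the Rayleigh
quotient; the only leak `N′(0) ≠ 0` is «reshape near the top» = lengthening in disguise). Proved. [cite: CechMatomaki2024, Remark 2.9] -/
theorem cmDefect_X_sq_of_admissible (Δ : ℝ) {N : ℝ[X]} (hN : Admissible N) :
    cmDefect Δ (X ^ 2) N = 0 := by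
  rw [cmDefect_X_sq, hN.2, mul_zero]

/-- Control (the detector is not vacuous): the non-optimal profile `P = X³` IS improvable — its defect
against `N = X²` is `−6·Δ⁻¹` (`≠ 0` for `Δ ≠ 0`; `𝔇/3 = (2/Δ)N′(1) − (6/Δ)N(1)` at admissible `N`). Proved. [cite: CechMatomaki2024, Remark 2.9] [cite: KowalskiMichelVanderKam2000, Thm. 6.1 (32) and §6 p. 19] -/
theorem cmDefect_X_cube_X_sq (Δ : ℝ) :
    cmDefect Δ (X ^ 3) (X ^ 2) = -(6 * Δ⁻¹) := by
  unfold cmDefect polarB secondMomentForm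
  rw [linForm_one, offDiagForm_one]
  have hd3 : derivative (X ^ 3 : ℝ[X]) = C 3 * X ^ 2 := by
    rw [derivative_X_pow]; norm_num
  have hdd3 : derivative (derivative (X ^ 3 : ℝ[X])) = C 6 * X := by
    rw [hd3, derivative_C_mul, derivative_X_sq, ← mul_assoc, ← map_mul]; norm_num
  have hdd2 : derivative (derivative (X ^ 2 : ℝ[X])) = C 2 := by
    rw [derivative_X_sq, derivative_C_mul, derivative_X, mul_one]
  have hX : unitIntegral (X : ℝ[X]) = 1 / 2 := by
    unfold unitIntegral
    simp only [eval_X]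
    rw [integral_id]
    norm_num
  have hX2 : unitIntegral (X ^ 2 : ℝ[X]) = 1 / 3 := by
    unfold unitIntegral
    simp only [eval_pow, eval_X]
    rw [integral_pow]
    norm_num
  have hI1 : unitIntegral (C 6 * X * C 2 : ℝ[X]) = 6 := by
    have : (C 6 * X * C 2 : ℝ[X]) = C 12 * X := by
      rw [mul_right_comm, ← map_mul]
      norm_num
    rw [this, unitIntegral_C_mul', hX]
    norm_num
  have hI2 : unitIntegral ((C 6 * X) ^ 2 : ℝ[X]) = 12 := by
    have : ((C 6 * X) ^ 2 : ℝ[X]) = C 36 * X ^ 2 := by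
      rw [mul_pow, ← map_pow]
      norm_num
    rw [this, unitIntegral_C_mul', hX2]
    norm_num
  rw [hdd3, hdd2, hd3, hI1, hI2, derivative_X_sq]
  simp only [eval_mul, eval_C, eval_pow, eval_X]
  ring

end Literature.NumberTheory.LFunctions.KMV2000
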